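import Mathlib

/-!
# TASK T-S5/U5.4a «Gaussian determinant formula» — the finite-dimensional Gaussian integral behind the Faddeev–Popov determinant in
# step (1b) of the comparison stubs S5 (LINE-19 ⟨24004⟩/⟨24335⟩) and U5 (LINE-20 ⟨24336⟩): typed obligation Prop, planner ym-idea-2 g17.

In the Laplace asymptotics of the orbit average `N_h(U) = ∫ h(U^g) dg` (T-S5.4 of `STUB-PLAN-S5U5-STEP1.md`) the leading term is a
Gaussian integral over the gauge algebra at the interior sites, `v ↦ exp(−β‖M v‖²)` with `M = M_FP(U)` the (square, invertible near the
identity) Faddeev–Popov operator `−Δ_I − ad(A)·d` on interior sites; its value is `(π/β)^{n/2}/|det M|`.  This file types exactly that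
finite-dimensional formula over Lebesgue measure on `Fin n → ℝ` (Mathlib's `volume` on the pi type), so that T-S5.4 can quote it.
Ingredients a prover will use: `integral_gaussian` (one variable), `MeasureTheory.integral_fintype_prod_eq_prod` (product form after the
change of variables), and the linear change of variables `MeasureTheory.Measure.map_linearMap_addHaar_eq_smul_addHaar` (`|det M|⁻¹`).

T-S5.4a `GaussianDeterminantFormula` (S–M).

HONEST LABEL: a Prop only; nothing is proved here; S5, U5, ⟨24004⟩ ⟨24335⟩ ⟨24336⟩ remain OPEN; the Yang–Mills mass gap is NOT proved by
this file.
-/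

set_option autoImplicit false

noncomputable section

open MeasureTheory Matrix

namespace Summit.QuantumFields.YangMills.Theorems.AllWindowsColdBoxBoxHighLine

/-- T-S5.4a **(Gaussian determinant formula; S–M)**: for an invertible real `n × n` matrix `M` and `β > 0`,
`∫_{ℝⁿ} exp(−β ‖M v‖²) dv = (√(π/β))ⁿ / |det M|`. -/
def GaussianDeterminantFormula : Prop :=
  ∀ (n : ℕ) (M : Matrix (Fin n) (Fin n) ℝ), M.det ≠ 0 → ∀ β : ℝ, 0 < β →
    ∫ v : Fin n → ℝ, Real.exp (-(β * (M.mulVec v ⬝ᵥ M.mulVec v))) = Real.sqrt (Real.pi / β) ^ n / |M.det|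

/-- Sanity instance of the statement's normalisation (`n = 1`, `M = 1`): the classical Gaussian integral, from Mathlib. -/
theorem gaussian_one_dim (β : ℝ) : ∫ x : ℝ, Real.exp (-(β * x ^ 2)) = Real.sqrt (Real.pi / β) := by
  simpa [neg_mul] using integral_gaussian β

end Summit.QuantumFields.YangMills.Theorems.AllWindowsColdBoxBoxHighLine

end
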